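import Summits.FinalStateConjecture.FinalStateConjecture.Theorems.ZeroEnergyKerrOrBombStationaryLimitReductionRecutCoveringJunctionCore
import Literature.Geometry.Lorentzian.CausalFutureProofs
import HarnessLib

/-!
# Route ZeroEnergyKerrOrBomb · crux `FinalStateFromKerrOrBomb` (stmt-FinalStateConjecture-17839), line `SketchIdeator1` —
# stub `stub_recutJunctionCoreB` (m5, boost-honest junction core), wave 8: STEP F — boost-general flat steering of
# radiation-zone events by their flat coordinates (F0 / F1a / F1b of the W17 plan)

Helper file (`--supports stmt-FinalStateConjecture-17839`; registered helper `recutJunction_flatSteer_boost`) of the lead's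
wave-8 stub worker W21 (2026-08-17). Plan `work/stubs/W17-boost-audit.md` §7.2 Step F; report `work/stubs/W21-report.md`.
Companions: `…RecutCoreBFlatSteer.lean` (pointwise flat time lines `recutJunction_flatTimeLine_point`, deep approximant
`recutJunction_deepApproximant`, whose conclusions enter here as hypotheses) and `…RecutCoreBAssembly.lean` (the merged hole
steering `recutJunction_holeSteer` — (α) p141985 for `r ≥ r₊ + δ`, (NH′) p153531 below —, whose conclusion enters here as a
hypothesis, and the assembly).

`recutJunction_flatSteer_boost` (§2, Step F WITHOUT isochrony). Hypotheses: monotone radii `Rᵢ → ∞`, Kerr identifications,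
  `cᵢ = 1`, (a_R) (binders of `SigM.stub_recutJunctionCoreB` verbatim); the boosted/isochronous DICHOTOMY of each hole (`Λᵢ e₀ = e₀`,
  or the rest time of lab-late certified coordinates lags the lab time by every `K` — orthochrony p153600 + p154132); the
  conclusions of `recutJunction_flatTimeLine_point`, `recutJunction_holeSteer`, `recutJunction_deepApproximant`. Conclusion: for `s, W ≥ 0` there are `K ≥ 0` and a lab time `τC > τ₀` such that every flat
  coordinate `y ∈ U₀` with `τC ≤ y⁰ ≤ τ₁` whose flat event is NOT recut-late (`Ψ₀ y ∉ Ω`, original points) OR whose lab time is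
  `≤ τ₁ − K` (intermediate points) has `Ψ₀ y ∈ J⁻(recutCertifiedSlab … R' τ₁)`, `R'ᵢ τ = Rᵢ(cᵢ τ − s) − W`.
  Proof. (F0) the lab vertical up to lab time `τ₁` stays in `U₀`: pointwise flat line to the flat slab piece. (F1) else the
  deep approximant `y' = y + t e₀ = Pᵢ Θᵢ x` (segment `[0, t] ⊆ U₀`, `x` far, late, deep, `(Θᵢ x)⁰ ≤ τ₁ + κ + 1`, `ψᵢ y' = Ψ₀ y'`),
  so `r(x) ≤ R'ᵢ τ₁` with the margins `(s + κ + L + 2, W + L)`. (F1a) `x⁰ ≤ τ₁`: hole steering AT THE APPROXIMANT,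
  `Ψ₀ y ≤ Ψ₀ y' = ψᵢ y' ∈ J⁻(slab)` — no transport back to `y`, hence no isochrony. (F1b) `x⁰ > τ₁`: impossible for a boosted
  hole (rest time lags lab time by `L + 1`); for an isochronous hole slide along the Kerr–Schild vertical `x + (u − t) e₀`,
  whose moved identification points are `y + u e₀` EXACTLY: either the parameter `u₀ = τ₁ − x⁰ + t ≥ 0` gives a certified
  doubly-late flat coordinate `y + u₀ e₀` of Kerr–Schild time exactly `τ₁` charting ((a_R)) to a recut slab point above `Ψ₀ y`,
  or `u₀ < 0` and `Ψ₀ y = ψᵢ y ∈ Ω` ((a_R) at `y`, Kerr–Schild time `x⁰ − t > τ₁`) — excluded by `Ψ₀ y ∉ Ω`, and by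
  `y⁰ ≤ τ₁ − K`, `K = κ + L`, since then the Kerr–Schild time of `y` is `≤ y⁰ + κ + L ≤ τ₁`.

Elementary; no named fact, nothing restated. References: O'Neill 1983, Ch. 14, pp. 402–403; Dafermos–Luk arXiv:1710.01722, Conj. 1 (b)–(c).
-/

set_option linter.dupNamespace false
set_option maxSynthPendingDepth 3

noncomputable section

open scoped Manifold ContDiff Topology
open Set Filter Function

namespace Summit.FinalStateConjecture.FinalStateConjecture.Theorems.SymplecticDualOfTheBomb

open Literature.Geometry.Lorentzian Summit.FinalStateConjecture.FinalStateConjecture.Theorems.OneLockedExplosion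

/-! ## §1 Private copies (sibling modules unbuilt today) -/

section Causal

variable {E : Type*} [NormedAddCommGroup E] [NormedSpace ℝ E] {H : Type*} [TopologicalSpace H]
  {I : ModelWithCorners ℝ E H} {n : ℕ∞ω} {M : Type*} [TopologicalSpace M] [ChartedSpace H M]
  [IsManifold I ∞ M] {g : LorentzianMetric I n M} {τ : TimeOrientation g}

/-- Transitivity of `J⁻` for sets, `T ⊆ J⁻(S) ⟹ J⁻(T) ⊆ J⁻(S)` (`C²` metric, no boundary). O'Neill 1983, Ch. 14, p. 402.
[folklore] -/
private theorem causalPast_subset_causalPast_of_subset_w8 [BoundarylessManifold I M] (hn : 2 ≤ n) {S T : Set M}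
    (hT : T ⊆ g.causalPast τ S) : g.causalPast τ T ⊆ g.causalPast τ S := fun p hp ↦ by
  -- private copy of `causalPast_subset_causalPast_of_subset` (…RecutJunctionCore, unbuilt today)
  have h : p ∈ g.causalFuture τ.reverse (g.causalFuture τ.reverse S) := LorentzianMetric.causalFuture_mono hT hp
  rwa [LorentzianMetric.causalFuture_causalFuture_eq hn S] at h

end Causal

section Copies

variable {𝓢 : Spacetime.{0} 4} {O : Set 𝓢.carrier} {k : ℕ} {Λ : lorentzGroup}

/-- An isochronous Lorentz transformation preserves the time coordinate. [folklore] -/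
private theorem lorentz_apply_zero_w8 (hΛ : (Λ : E4 ≃L[ℝ] E4) (E4.basisVector 0) = E4.basisVector 0) (v : E4) :
    (Λ : E4 ≃L[ℝ] E4) v 0 = v 0 := by
  -- private copy of `lorentz_apply_zero_of_map_basisVector` (…RecutCoreCOFlatSteer, p146004, unbuilt today)
  have h := Λ.2 (E4.basisVector 0) v
  rw [hΛ, Minkowski.bilin_basisVector_zero_left, Minkowski.bilin_basisVector_zero_left] at h
  linarith

/-- Rest time of an isochronous motion, `(P⁻¹ y)⁰ = y⁰ − c⁰`. [folklore] -/
private theorem poincareInv_apply_zero_w8 (hΛ : (Λ : E4 ≃L[ℝ] E4) (E4.basisVector 0) = E4.basisVector 0)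
    (c₀ y : E4) : poincareInv Λ c₀ y 0 = y 0 - c₀ 0 := by
  -- private copy of `poincareInv_apply_zero_of_map_basisVector` (…RecutCoreCOFlatSteer, p146004, unbuilt today)
  have h := lorentz_apply_zero_w8 hΛ ((Λ : E4 ≃L[ℝ] E4).symm (y - c₀))
  rw [ContinuousLinearEquiv.apply_symm_apply] at h
  rw [poincareInv, ← h]
  rfl

/-- `(y + t e₀)⁰ = y⁰ + t`. [folklore] -/
private theorem add_smul_basisVector_apply_zero_w8' (y : E4) (t : ℝ) :
    (y + t • E4.basisVector 0) 0 = y 0 + t := by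
  simp [E4.basisVector]

variable (d : StationaryFinalStateDecomposition 𝓢 O k) {M a c r₀ : Fin d.N → ℝ} {Θ : Fin d.N → E4 → E4}

/-- Two-sided radius comparison `r(u) ≤ A.radius (Θ u) + L₂` on the Kerr exterior. [folklore] -/
private theorem radius_le_adaptedRadius_add_w8 {𝓑 : StationaryAFBlackHole.{0}} {A : 𝓑.AdaptedChart}
    {M a c r₀ : ℝ} {Θ : E4 → E4} (h : IsKerrChartedWith 𝓑 A M a c r₀ Θ) :
    ∃ L₂ : ℝ, 0 ≤ L₂ ∧ ∀ u ∈ (Kerr.exterior M a : Set E4), Kerr.radius a u ≤ A.radius (Θ u) + L₂ := by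
  -- private copy of `kerrChartedWith_radius_le_adaptedRadius_add` (…RecutCoreCOFlatSteer, p146004, unbuilt today)
  obtain ⟨hsub, -, -, -, -, -, -, -, -, -, L, hL⟩ := h
  obtain ⟨C, hC⟩ := A.exists_abs_radius_sub_spatialNorm_le
  have hrp : 0 < Kerr.rPlus M a := hsub.pos.trans_le (le_add_of_nonneg_right (Real.sqrt_nonneg _))
  refine ⟨|L| + |C| + Kerr.rPlus M a + 1, by positivity, fun u hu ↦ ?_⟩
  by_cases hfar : Kerr.rPlus M a + 1 ≤ Kerr.radius a u
  · have h1 := (abs_le.1 (hL u hu hfar).2.1).1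
    linarith [le_abs_self L, abs_nonneg C]
  · have h1 := (abs_le.1 (hC (Θ u))).1
    have h2 : 0 ≤ E4.spatialNorm (Θ u) := E4.spatialNorm_nonneg _
    linarith [le_abs_self C, abs_nonneg L, not_le.1 hfar]

/-- The moved identification point `Pᵢ (Θᵢ x)`, `x ∈ Kerr.exterior`, lies in the moved adapted domain. [folklore] -/
private theorem poincare_kerr_mem_domain_w8 {i : Fin d.N}
    (hW : IsKerrChartedWith (d.hole i) (d.adapted i) (M i) (a i) (c i) (r₀ i) (Θ i))
    {x : E4} (hx : x ∈ (Kerr.exterior (M i) (a i) : Set E4)) :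
    ((d.motion i).1 : E4 ≃L[ℝ] E4) (Θ i x) + (d.motion i).2 ∈ ((d.background i).domain : Set E4) := by
  -- private copy of `poincare_kerr_mem_domain` (…RecutCoreCOFlatSteer, p146004, unbuilt today)
  obtain ⟨-, -, -, hr₀, -, -, hΘm, -⟩ := hW
  show poincareInv (d.motion i).1 (d.motion i).2 _ ∈ ((d.adapted i).domain : Set E4)
  rw [poincareInv_apply_add]
  exact hΘm (Kerr.mem_region.2 ((max_le_max hr₀.le le_rfl).trans_lt (Kerr.mem_exterior.1 hx)))

/-- `T`-equivariance with unit time scale: `Θᵢ (x + t e₀) = Θᵢ x + t e₀` on the Kerr exterior when `cᵢ = 1`. [folklore] -/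
private theorem kerr_apply_add_smul_w8 {i : Fin d.N}
    (hW : IsKerrChartedWith (d.hole i) (d.adapted i) (M i) (a i) (c i) (r₀ i) (Θ i)) (hc1 : c i = 1)
    {x : E4} (hx : x ∈ (Kerr.exterior (M i) (a i) : Set E4)) (t : ℝ) :
    Θ i (x + t • E4.basisVector 0) = Θ i x + t • E4.basisVector 0 := by
  -- private copy of `kerr_apply_add_smul` (…RecutCoreCOFlatSteer, p146004, unbuilt today)
  obtain ⟨-, -, -, hr₀, -, -, -, hΘe, -⟩ := hW
  have h := hΘe x (Kerr.mem_region.2 ((max_le_max hr₀.le le_rfl).trans_lt (Kerr.mem_exterior.1 hx))) t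
  rwa [hc1, one_mul] at h

/-- Membership in the recut certified tube from the Kerr–Schild data (`x⁰ > τ₁`, `r(x) ≤ R'ᵢ x⁰`). [folklore] -/
private theorem chart_mem_recutCertifiedLate_of_kerr_w8 {i : Fin d.N} (R' : Fin d.N → ℝ → ℝ) {τ₁ : ℝ}
    {x : E4} (hx : x ∈ (Kerr.exterior (M i) (a i) : Set E4)) (hx0 : τ₁ < x 0)
    (hxr : Kerr.radius (a i) x ≤ R' i (x 0))
    (h₀ : ((d.motion i).1 : E4 ≃L[ℝ] E4) (Θ i x) + (d.motion i).2 ∈ (d.background i).domain) :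
    d.toOver.chart i ⟨((d.motion i).1 : E4 ≃L[ℝ] E4) (Θ i x) + (d.motion i).2, h₀⟩ ∈
      recutCertifiedLate d M a Θ R' τ₁ := by
  -- private copy of `chart_mem_recutCertifiedLate_of_kerr` (…RecutCoreCOFlatSteer, p146004, unbuilt today)
  set z : E4 := ((d.motion i).1 : E4 ≃L[ℝ] E4) x + (d.motion i).2 with hz
  have hPz : poincareInv (d.motion i).1 (d.motion i).2 z = x := poincareInv_apply_add _ _ _
  have hzdom : z ∈ ((recutBackground d M a i).domain : Set E4) := by
    show poincareInv (d.motion i).1 (d.motion i).2 z ∈ (Kerr.exterior (M i) (a i) : Set E4)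
    rw [hPz]; exact hx
  refine Or.inr (mem_iUnion.2 ⟨i, mem_image_of_mem _ ?_⟩)
  refine ⟨z, ⟨⟨z, hzdom⟩, ⟨?_, ?_⟩, rfl⟩, ?_⟩
  · show τ₁ < (poincareInv (d.motion i).1 (d.motion i).2 z) 0
    rw [hPz]; exact hx0
  · show Kerr.radius (a i) (poincareInv (d.motion i).1 (d.motion i).2 z) ≤
      R' i ((poincareInv (d.motion i).1 (d.motion i).2 z) 0)
    rw [hPz]; exact hxr
  · show ((d.motion i).1 : E4 ≃L[ℝ] E4) (Θ i (poincareInv (d.motion i).1 (d.motion i).2 z)) + (d.motion i).2 = _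
    rw [hPz]

/-- Membership in the recut certified slab from the Kerr–Schild data (`x⁰ = τ₁`, `r(x) ≤ R'ᵢ τ₁`). [folklore] -/
private theorem chart_mem_recutCertifiedSlab_of_kerr_w8 {i : Fin d.N} (R' : Fin d.N → ℝ → ℝ) {τ₁ : ℝ}
    {x : E4} (hx : x ∈ (Kerr.exterior (M i) (a i) : Set E4)) (hx0 : x 0 = τ₁)
    (hxr : Kerr.radius (a i) x ≤ R' i τ₁)
    (h₀ : ((d.motion i).1 : E4 ≃L[ℝ] E4) (Θ i x) + (d.motion i).2 ∈ (d.background i).domain) :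
    d.toOver.chart i ⟨((d.motion i).1 : E4 ≃L[ℝ] E4) (Θ i x) + (d.motion i).2, h₀⟩ ∈
      recutCertifiedSlab d M a Θ R' τ₁ := by
  -- private copy of `chart_mem_recutCertifiedSlab_of_kerr` (…RecutCoreBDichotomy, p154132, unbuilt today)
  set z : E4 := ((d.motion i).1 : E4 ≃L[ℝ] E4) x + (d.motion i).2 with hz
  have hPz : poincareInv (d.motion i).1 (d.motion i).2 z = x := poincareInv_apply_add _ _ _
  have hzdom : z ∈ ((recutBackground d M a i).domain : Set E4) := by
    show poincareInv (d.motion i).1 (d.motion i).2 z ∈ (Kerr.exterior (M i) (a i) : Set E4)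
    rw [hPz]; exact hx
  refine Or.inr (mem_iUnion.2 ⟨i, mem_image_of_mem _ ?_⟩)
  refine ⟨z, ⟨⟨z, hzdom⟩, ⟨?_, ?_⟩, rfl⟩, ?_⟩
  · show (poincareInv (d.motion i).1 (d.motion i).2 z) 0 = τ₁
    rw [hPz]; exact hx0
  · show Kerr.radius (a i) (poincareInv (d.motion i).1 (d.motion i).2 z) ≤ R' i τ₁
    rw [hPz]; exact hxr
  · show ((d.motion i).1 : E4 ≃L[ℝ] E4) (Θ i (poincareInv (d.motion i).1 (d.motion i).2 z)) + (d.motion i).2 = _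
    rw [hPz]

end Copies

/-! ## §2 Step F: boost-general flat steering -/

/-- **Registered helper `recutJunction_flatSteer_boost` (Step F of the m5 junction core, boost-general).** See the module
docstring for hypotheses, conclusion and proof. Dafermos–Luk arXiv:1710.01722, Conjecture 1 (b)–(c). [folklore] -/
theorem recutJunction_flatSteer_boost : ∀ {𝓢 : Spacetime.{0} 4} {O : Set 𝓢.carrier} {k : ℕ} (d : StationaryFinalStateDecomposition 𝓢 O k) (M a c r₀ : Fin d.N → ℝ) (Θ : Fin d.N → E4 → E4) (R : Fin d.N → ℝ → ℝ), (∀ i, Monotone (R i)) → (∀ i, Tendsto (R i) atTop atTop) → (∀ i, IsKerrChartedWith (d.hole i) (d.adapted i) (M i) (a i) (c i) (r₀ i) (Θ i)) → (∀ i, c i = 1) → (∀ (i : Fin d.N) (y : (d.background i).domain) (h : (y : E4) ∈ d.toOver.flatDomain), d.toOver.τ₀ < (d.background i).time y.1 → d.toOver.τ₀ < (y : E4) 0 → (d.background i).radius y.1 ≤ R i ((d.background i).time y.1) → d.toOver.chart i y = d.toOver.flatChart ⟨y, h⟩) → (∀ i : Fin d.N, ((d.motion i).1 : E4 ≃L[ℝ]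 E4) (E4.basisVector 0) = E4.basisVector 0 ∨ ∀ K : ℝ, ∃ T : ℝ, ∀ y : E4, T ≤ y 0 → (d.background i).radius y ≤ R i ((d.background i).time y) → (d.background i).time y ≤ y 0 - K) → (∃ τF : ℝ, d.toOver.τ₀ < τF ∧ ∀ (y : E4) (S : ℝ), τF ≤ y 0 → 0 ≤ S → (∀ s ∈ Set.Icc (0 : ℝ) S, y + s • E4.basisVector 0 ∈ (d.toOver.flatDomain : Set E4)) → ∀ (h₀ : y ∈ (d.toOver.flatDomain : Set E4)) (h₁ : y + S • E4.basisVector 0 ∈ (d.toOver.flatDomain : Set E4)), d.toOver.flatChart ⟨y, h₀⟩ ∈ 𝓢.metric.causalPast 𝓢.timeOrientation {d.toOver.flatChart ⟨y + S • E4.basisVector 0, h₁⟩}) → (∀ i : Fin d.N, ∃ T : ℝ, ∀ (R' : Fin d.N → ℝ → ℝ) (τ₁ : ℝ), ∀ x ∈ (Kerr.exterior (M i) (a i) : Set E4), T ≤ Θ i x 0 → (d.adapted i).radius (Θ i x) ≤ R i (Θ i x 0) → x 0 ≤ τ₁ → Kerr.radius (a i) x ≤ R' i τ₁ → Kerr.rPlus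 (M i) (a i) + 1 ≤ R' i τ₁ → ∀ h₀ : ((d.motion i).1 : E4 ≃L[ℝ] E4) (Θ i x) + (d.motion i).2 ∈ (d.background i).domain, d.toOver.chart i ⟨((d.motion i).1 : E4 ≃L[ℝ] E4) (Θ i x) + (d.motion i).2, h₀⟩ ∈ 𝓢.metric.causalPast 𝓢.timeOrientation (recutCertifiedSlab d M a Θ R' τ₁)) → (∀ s₀ W₀ Tstar Rstar : ℝ, 0 ≤ s₀ → 0 ≤ W₀ → ∃ T : ℝ, d.toOver.τ₀ < T ∧ ∀ (τ₁ : ℝ) (y : d.toOver.flatDomain), T ≤ (y : E4) 0 → (y : E4) 0 ≤ τ₁ → (∃ t ∈ Set.Icc (0 : ℝ) (τ₁ - (y : E4) 0), (y : E4) + t • E4.basisVector 0 ∉ (d.toOver.flatDomain : Set E4)) → ∃ (i : Fin d.N) (t : ℝ) (x : E4), 0 ≤ t ∧ (y : E4) 0 + t ≤ τ₁ ∧ (∀ t' ∈ Set.Icc (0 : ℝ) t, (y : E4) + t' • E4.basisVector 0 ∈ (d.toOver.flatDomain : Set E4)) ∧ x ∈ (Kerr.exterior (M i) (a i) : Set E4)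 ∧ ((d.motion i).1 : E4 ≃L[ℝ] E4) (Θ i x) + (d.motion i).2 = (y : E4) + t • E4.basisVector 0 ∧ Rstar ≤ Kerr.radius (a i) x ∧ Tstar ≤ Θ i x 0 ∧ (d.adapted i).radius (Θ i x) ≤ R i (Θ i x 0 - s₀) - W₀ ∧ Θ i x 0 ≤ (y : E4) 0 + t + |(d.motion i).2 0| + 1 ∧ ∀ (h : (y : E4) + t • E4.basisVector 0 ∈ (d.background i).domain) (h' : (y : E4) + t • E4.basisVector 0 ∈ (d.toOver.flatDomain : Set E4)), d.toOver.chart i ⟨(y : E4) + t • E4.basisVector 0, h⟩ = d.toOver.flatChart ⟨(y : E4) + t • E4.basisVector 0, h'⟩) → ∀ s W : ℝ, 0 ≤ s → 0 ≤ W → ∃ K τC : ℝ, 0 ≤ K ∧ d.toOver.τ₀ < τC ∧ ∀ (τ₁ : ℝ) (y : d.toOver.flatDomain), τC ≤ (y : E4) 0 → (y : E4) 0 ≤ τ₁ → (d.toOver.flatChart y ∉ recutCertifiedLate d M a Θ (fun i τ ↦ R i (c i * τ - s) - W) τ₁ ∨ (y : E4) 0 ≤ τ₁ - K) → d.toOver.flatChart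 y ∈ 𝓢.metric.causalPast 𝓢.timeOrientation (recutCertifiedSlab d M a Θ (fun i τ ↦ R i (c i * τ - s) - W) τ₁) := by
  intro 𝓢 O k d M a c r₀ Θ R hRmono hRtop hW hc1 hRa hdich hline hHS hDA s W hs hWnn
  -- the transported radii, read with `cᵢ = 1`
  set R' : Fin d.N → ℝ → ℝ := fun i τ ↦ R i (c i * τ - s) - W with hR'_def
  have hR' : ∀ i τ, R' i τ = R i (τ - s) - W := fun i τ ↦ by simp [hR'_def, hc1 i]
  have hR'mono : ∀ i τ τ', τ ≤ τ' → R' i τ ≤ R' i τ' := fun i τ τ' h ↦ by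
    rw [hR', hR']; linarith [hRmono i (show τ - s ≤ τ' - s by linarith)]
  have h2le : (2 : ℕ∞ω) ≤ ((⊤ : ℕ∞) : ℕ∞ω) := WithTop.coe_le_coe.mpr le_top
  -- constants of the identifications: tilt / radius comparison `L`, offsets `κ`
  have hglob := fun i ↦ kerrChartedWith_global_bounds (hW i)
  choose L₁ hL₁0 hL₁ using hglob
  have hrad := fun i ↦ radius_le_adaptedRadius_add_w8 (hW i)
  choose L₂ hL₂0 hL₂ using hrad
  obtain ⟨L', hL'⟩ := Finite.exists_le fun i ↦ max (L₁ i) (L₂ i)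
  obtain ⟨κ', hκ'⟩ := Finite.exists_le fun i : Fin d.N ↦ |(d.motion i).2 0|
  set L : ℝ := max L' 0 with hL_def
  set κ : ℝ := max κ' 0 with hκ_def
  have hL0 : 0 ≤ L := le_max_right _ _
  have hκ0 : 0 ≤ κ := le_max_right _ _
  have hκi : ∀ i, |(d.motion i).2 0| ≤ κ := fun i ↦ (hκ' i).trans (le_max_left _ _)
  have htilt : ∀ i, ∀ u ∈ (Kerr.exterior (M i) (a i) : Set E4), |Θ i u 0 - u 0| ≤ L := fun i u hu ↦ by
    have h := (hL₁ i u hu).1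
    rw [hc1 i, one_mul] at h
    exact h.trans ((le_max_left _ _).trans ((hL' i).trans (le_max_left _ _)))
  have hradle : ∀ i, ∀ u ∈ (Kerr.exterior (M i) (a i) : Set E4),
      Kerr.radius (a i) u ≤ (d.adapted i).radius (Θ i u) + L := fun i u hu ↦ by
    have h1 : L₂ i ≤ L := (le_max_right _ _).trans ((hL' i).trans (le_max_left _ _))
    linarith [hL₂ i u hu]
  -- the dichotomy thresholds (`K := L + 1` for boosted holes)
  have hth : ∀ i, ∃ T : ℝ, ((d.motion i).1 : E4 ≃L[ℝ] E4) (E4.basisVector 0) = E4.basisVector 0 ∨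
      ∀ y : E4, T ≤ y 0 → (d.background i).radius y ≤ R i ((d.background i).time y) →
        (d.background i).time y ≤ y 0 - (L + 1) := fun i ↦ by
    rcases hdich i with h | h
    · exact ⟨0, Or.inl h⟩
    · obtain ⟨T, hT⟩ := h (L + 1)
      exact ⟨T, Or.inr hT⟩
  choose Td hTd using hth
  -- hole-steering thresholds, the flat line, growth of the radii
  choose Ths hThs using hHS
  obtain ⟨τF, -, hline⟩ := hline
  have hgrow := fun i ↦ eventually_atTop.1 ((hRtop i).eventually_ge_atTop (Kerr.rPlus (M i) (a i) + 1 + W))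
  choose TR hTR using hgrow
  -- the deep approximant at margins `(s + κ + L + 2, W + L)`, request `T* := max thresholds` (no radius request)
  obtain ⟨Tst, hTst⟩ := Finite.exists_le fun i ↦ Ths i
  obtain ⟨TA, -, hA⟩ := hDA (s + κ + L + 2) (W + L) Tst 0 (by positivity) (by positivity)
  -- thresholds
  obtain ⟨T₁, hT₁⟩ := Finite.exists_le fun i ↦ max (Td i) (TR i + s)
  set τC : ℝ := max (max TA τF) (max T₁ (d.toOver.τ₀ + L + 1)) with hτC_def
  have hTAC : TA ≤ τC := (le_max_left _ _).trans (le_max_left _ _)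
  have hτFC : τF ≤ τC := (le_max_right _ _).trans (le_max_left _ _)
  have hT₁C : T₁ ≤ τC := (le_max_left _ _).trans (le_max_right _ _)
  have hτ₀C : d.toOver.τ₀ + L + 1 ≤ τC := (le_max_right _ _).trans (le_max_right _ _)
  refine ⟨κ + L, τC, by positivity, by linarith, fun τ₁ y hyC hyτ hside ↦ ?_⟩
  have hi1 : ∀ i, Td i ≤ τC ∧ TR i + s ≤ τC := fun i ↦
    ⟨(le_max_left _ _).trans ((hT₁ i).trans hT₁C), (le_max_right _ _).trans ((hT₁ i).trans hT₁C)⟩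
  -- (F0) the vertical segment up to lab time `τ₁` stays in the flat domain
  by_cases hseg : ∀ t ∈ Icc (0 : ℝ) (τ₁ - (y : E4) 0),
      (y : E4) + t • E4.basisVector 0 ∈ (d.toOver.flatDomain : Set E4)
  · have hS : 0 ≤ τ₁ - (y : E4) 0 := sub_nonneg.2 hyτ
    have h₁ := hseg _ ⟨hS, le_rfl⟩
    have hend : d.toOver.flatChart ⟨(y : E4) + (τ₁ - (y : E4) 0) • E4.basisVector 0, h₁⟩ ∈
        recutCertifiedSlab d M a Θ R' τ₁ := by
      refine Or.inl (mem_image_of_mem _ ?_)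
      show ((y : E4) + (τ₁ - (y : E4) 0) • E4.basisVector 0) 0 = τ₁
      simp [E4.basisVector]
    have h := hline (y : E4) (τ₁ - (y : E4) 0) (hτFC.trans hyC) hS hseg y.2 h₁
    exact LorentzianMetric.causalFuture_mono (singleton_subset_iff.2 hend) h
  -- (F1) the deep approximant of the first exit
  push Not at hseg
  obtain ⟨i, t, x, ht0, htτ, hsegt, hx, hPx, -, hTstx, hdeep, hB1b, hagree⟩ :=
    hA τ₁ y (hTAC.trans hyC) hyτ hseg
  obtain ⟨hTdi, hTRi⟩ := hi1 i
  obtain ⟨hc0a, hc0b⟩ := abs_le.1 (hκi i)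
  obtain ⟨hx0a, hx0b⟩ := abs_le.1 (htilt i x hx)
  have hThsx : Ths i ≤ Θ i x 0 := (hTst i).trans hTstx
  -- the approximant coordinate `y' = y + t e₀`
  set y' : E4 := (y : E4) + t • E4.basisVector 0 with hy'_def
  have hy'0 : y' 0 = (y : E4) 0 + t := add_smul_basisVector_apply_zero_w8' _ _
  have hy'U : y' ∈ (d.toOver.flatDomain : Set E4) := hsegt t ⟨ht0, le_rfl⟩
  have hy'dom : y' ∈ ((d.background i).domain : Set E4) := by
    rw [← hPx]; exact poincare_kerr_mem_domain_w8 d (hW i) hx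
  have hy'time : (d.background i).time y' = Θ i x 0 := by
    rw [← hPx]
    show poincareInv (d.motion i).1 (d.motion i).2 _ 0 = _
    rw [poincareInv_apply_add]
  have hy'rad : (d.background i).radius y' = (d.adapted i).radius (Θ i x) := by
    rw [← hPx]
    show (d.adapted i).radius (poincareInv (d.motion i).1 (d.motion i).2 _) = _
    rw [poincareInv_apply_add]
  -- (d1) old tube, (d2) recut radius, growth, flat prefix, agreement
  have hΘx0 : Θ i x 0 ≤ τ₁ + κ + 1 := by linarith [hκi i]
  have hd1 : (d.adapted i).radius (Θ i x) ≤ R i (Θ i x 0) := by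
    have hm : R i (Θ i x 0 - (s + κ + L + 2)) ≤ R i (Θ i x 0) := hRmono i (by linarith)
    linarith
  have hd2 : Kerr.radius (a i) x ≤ R' i τ₁ := by
    rw [hR']
    have hm : R i (Θ i x 0 - (s + κ + L + 2)) ≤ R i (τ₁ - s) := hRmono i (by linarith)
    linarith [hradle i x hx]
  have hgrow1 : Kerr.rPlus (M i) (a i) + 1 ≤ R' i τ₁ := by
    rw [hR']; linarith [hTR i (τ₁ - s) (by linarith)]
  have hpre : d.toOver.flatChart y ∈ 𝓢.metric.causalPast 𝓢.timeOrientation {d.toOver.flatChart ⟨y', hy'U⟩} :=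
    hline (y : E4) t (hτFC.trans hyC) ht0 hsegt y.2 hy'U
  have hagree' : d.toOver.chart i ⟨y', hy'dom⟩ = d.toOver.flatChart ⟨y', hy'U⟩ := hagree hy'dom hy'U
  -- (F1a) Kerr–Schild time of `x` at most `τ₁`: hole steering at the approximant
  by_cases hxA : x 0 ≤ τ₁
  · have key : ∀ (z : E4) (hz : z ∈ ((d.background i).domain : Set E4)),
        z = ((d.motion i).1 : E4 ≃L[ℝ] E4) (Θ i x) + (d.motion i).2 →
          d.toOver.chart i ⟨z, hz⟩ ∈ 𝓢.metric.causalPast 𝓢.timeOrientation (recutCertifiedSlab d M a Θ R' τ₁) := by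
      rintro z hz rfl
      exact hThs i R' τ₁ x hx hThsx hd1 hxA hd2 hgrow1 hz
    have hq := key y' hy'dom hPx.symm
    rw [hagree'] at hq
    exact causalPast_subset_causalPast_of_subset_w8 h2le (singleton_subset_iff.2 hq) hpre
  -- (F1b) Kerr–Schild time of `x` above `τ₁`
  push Not at hxA
  rcases hTd i with hiso | hboost
  swap
  · -- a boosted hole: the rest time of `y'` lags its lab time by `L + 1` — contradiction
    exfalso
    have hcert' : (d.background i).radius y' ≤ R i ((d.background i).time y') := by
      rw [hy'rad, hy'time]; exact hd1
    have h := hboost y' (by rw [hy'0]; linarith) hcert'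
    rw [hy'time, hy'0] at h
    linarith
  -- an isochronous hole: slide along the Kerr–Schild vertical `x + (u − t) e₀ ↦ y + u e₀`
  have hslide : ∀ u : ℝ, ((d.motion i).1 : E4 ≃L[ℝ] E4) (Θ i (x + (u - t) • E4.basisVector 0)) + (d.motion i).2 =
      (y : E4) + u • E4.basisVector 0 := fun u ↦ by
    rw [kerr_apply_add_smul_w8 d (hW i) (hc1 i) hx, map_add, map_smul, hiso, add_right_comm, hPx, hy'_def, add_assoc,
      ← add_smul]
    congr 2; ring
  have hxu : ∀ u : ℝ, x + (u - t) • E4.basisVector 0 ∈ (Kerr.exterior (M i) (a i) : Set E4) := fun u ↦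
    Kerr.add_smul_basisVector_zero_mem_region hx _
  have hxu0 : ∀ u : ℝ, (x + (u - t) • E4.basisVector 0) 0 = x 0 + (u - t) := fun u ↦
    add_smul_basisVector_apply_zero_w8' _ _
  have hxur : ∀ u : ℝ, Kerr.radius (a i) (x + (u - t) • E4.basisVector 0) = Kerr.radius (a i) x := fun u ↦
    Kerr.radius_add_time_smul_basisVector _ _ _
  have hΘu0 : ∀ u : ℝ, Θ i (x + (u - t) • E4.basisVector 0) 0 = Θ i x 0 + (u - t) := fun u ↦ by
    rw [kerr_apply_add_smul_w8 d (hW i) (hc1 i) hx, add_smul_basisVector_apply_zero_w8']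
  have hΘur : ∀ u : ℝ, (d.adapted i).radius (Θ i (x + (u - t) • E4.basisVector 0)) = (d.adapted i).radius (Θ i x) :=
    fun u ↦ by rw [kerr_apply_add_smul_w8 d (hW i) (hc1 i) hx, adaptedRadius_add_smul_basisVector]
  -- rest / lab / certification data of the slid chart points, for (a_R)
  have hrestu : ∀ u : ℝ, (d.background i).time (((d.motion i).1 : E4 ≃L[ℝ] E4) (Θ i (x + (u - t) • E4.basisVector 0)) +
      (d.motion i).2) = Θ i x 0 + (u - t) := fun u ↦ by
    show poincareInv (d.motion i).1 (d.motion i).2 _ 0 = _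
    rw [poincareInv_apply_add, hΘu0]
  have hradu : ∀ u : ℝ, (d.background i).radius (((d.motion i).1 : E4 ≃L[ℝ] E4) (Θ i (x + (u - t) • E4.basisVector 0)) +
      (d.motion i).2) = (d.adapted i).radius (Θ i x) := fun u ↦ by
    show (d.adapted i).radius (poincareInv (d.motion i).1 (d.motion i).2 _) = _
    rw [poincareInv_apply_add, hΘur]
  have hlabu : ∀ u : ℝ, (((d.motion i).1 : E4 ≃L[ℝ] E4) (Θ i (x + (u - t) • E4.basisVector 0)) + (d.motion i).2) 0 =
      (y : E4) 0 + u := fun u ↦ by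
    rw [hslide, add_smul_basisVector_apply_zero_w8']
  have hcertu : ∀ u : ℝ, τ₁ - x 0 ≤ u - t →
      (d.background i).radius (((d.motion i).1 : E4 ≃L[ℝ] E4) (Θ i (x + (u - t) • E4.basisVector 0)) + (d.motion i).2) ≤
        R i ((d.background i).time (((d.motion i).1 : E4 ≃L[ℝ] E4) (Θ i (x + (u - t) • E4.basisVector 0)) +
          (d.motion i).2)) := fun u hu ↦ by
    rw [hradu, hrestu]
    have hm : R i (Θ i x 0 - (s + κ + L + 2)) ≤ R i (Θ i x 0 + (u - t)) := hRmono i (by linarith)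
    linarith
  by_cases hu₀ : 0 ≤ τ₁ - x 0 + t
  · -- the slid point of Kerr–Schild time EXACTLY `τ₁` is a certified doubly-late flat coordinate above `y`
    set u₀ : ℝ := τ₁ - x 0 + t with hu₀_def
    have hu₀t : u₀ ≤ t := by rw [hu₀_def]; linarith
    have hxk0 : (x + (u₀ - t) • E4.basisVector 0) 0 = τ₁ := by rw [hxu0, hu₀_def]; ring
    have hxkr : Kerr.radius (a i) (x + (u₀ - t) • E4.basisVector 0) ≤ R' i τ₁ := by rw [hxur]; exact hd2
    have hykU : (y : E4) + u₀ • E4.basisVector 0 ∈ (d.toOver.flatDomain : Set E4) := hsegt u₀ ⟨hu₀, hu₀t⟩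
    have hykdom : (y : E4) + u₀ • E4.basisVector 0 ∈ ((d.background i).domain : Set E4) := by
      rw [← hslide u₀]; exact poincare_kerr_mem_domain_w8 d (hW i) (hxu u₀)
    have key : ∀ (z : E4) (hz : z ∈ ((d.background i).domain : Set E4)) (hzU : z ∈ (d.toOver.flatDomain : Set E4)),
        z = ((d.motion i).1 : E4 ≃L[ℝ] E4) (Θ i (x + (u₀ - t) • E4.basisVector 0)) + (d.motion i).2 →
          d.toOver.flatChart ⟨z, hzU⟩ ∈ recutCertifiedSlab d M a Θ R' τ₁ := by
      rintro z hz hzU rfl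
      have hrest : d.toOver.τ₀ < (d.background i).time (((d.motion i).1 : E4 ≃L[ℝ] E4)
          (Θ i (x + (u₀ - t) • E4.basisVector 0)) + (d.motion i).2) := by
        rw [hrestu, hu₀_def]; linarith
      have hlab : d.toOver.τ₀ < (((d.motion i).1 : E4 ≃L[ℝ] E4) (Θ i (x + (u₀ - t) • E4.basisVector 0)) +
          (d.motion i).2) 0 := by
        rw [hlabu]; linarith
      rw [← hRa i ⟨_, hz⟩ hzU hrest hlab (hcertu u₀ (by rw [hu₀_def]; linarith))]
      exact chart_mem_recutCertifiedSlab_of_kerr_w8 d R' (hxu u₀) hxk0 hxkr hz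
    have hqk := key _ hykdom hykU (hslide u₀).symm
    have hpre' := hline (y : E4) u₀ (hτFC.trans hyC) hu₀ (fun t' ht' ↦ hsegt t' ⟨ht'.1, ht'.2.trans hu₀t⟩) y.2 hykU
    exact LorentzianMetric.causalFuture_mono (singleton_subset_iff.2 hqk) hpre'
  · -- the hole preimage of `y` itself has Kerr–Schild time `> τ₁`: `Ψ₀ y = ψᵢ y ∈ Ω`
    push Not at hu₀
    have hx00 : τ₁ < (x + (0 - t) • E4.basisVector 0) 0 := by rw [hxu0]; linarith
    have hx0r : Kerr.radius (a i) (x + (0 - t) • E4.basisVector 0) ≤ R' i ((x + (0 - t) • E4.basisVector 0) 0) := by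
      rw [hxur]
      exact hd2.trans (hR'mono i _ _ hx00.le)
    have hy0 : (y : E4) + (0 : ℝ) • E4.basisVector 0 = (y : E4) := by rw [zero_smul, add_zero]
    have hydom : (y : E4) ∈ ((d.background i).domain : Set E4) := by
      rw [← hy0, ← hslide 0]; exact poincare_kerr_mem_domain_w8 d (hW i) (hxu 0)
    have hΩ : d.toOver.flatChart y ∈ recutCertifiedLate d M a Θ R' τ₁ := by
      have key : ∀ (z : E4) (hz : z ∈ ((d.background i).domain : Set E4)) (hzU : z ∈ (d.toOver.flatDomain : Set E4)),
          z = ((d.motion i).1 : E4 ≃L[ℝ] E4) (Θ i (x + (0 - t) • E4.basisVector 0)) + (d.motion i).2 →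
            d.toOver.flatChart ⟨z, hzU⟩ ∈ recutCertifiedLate d M a Θ R' τ₁ := by
        rintro z hz hzU rfl
        have hrest : d.toOver.τ₀ < (d.background i).time (((d.motion i).1 : E4 ≃L[ℝ] E4)
            (Θ i (x + (0 - t) • E4.basisVector 0)) + (d.motion i).2) := by
          rw [hrestu]; linarith
        have hlab : d.toOver.τ₀ < (((d.motion i).1 : E4 ≃L[ℝ] E4) (Θ i (x + (0 - t) • E4.basisVector 0)) +
            (d.motion i).2) 0 := by
          rw [hlabu]; linarith
        rw [← hRa i ⟨_, hz⟩ hzU hrest hlab (hcertu 0 (by linarith))]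
        exact chart_mem_recutCertifiedLate_of_kerr_w8 d R' (hxu 0) hx00 hx0r hz
      have h := key (y : E4) hydom y.2 ((hslide 0).trans hy0).symm
      exact h
    rcases hside with hnot | hyK
    · exact (hnot hΩ).elim
    · exfalso
      -- isochronous: the rest time of `y` is `y⁰ − cᵢ⁰`, so the Kerr–Schild time of its preimage is `≤ y⁰ + κ + L ≤ τ₁`
      have htime : (d.background i).time (y : E4) = (y : E4) 0 - (d.motion i).2 0 := poincareInv_apply_zero_w8 hiso _ _
      have htime' : (d.background i).time (y : E4) = Θ i x 0 + (0 - t) := by rw [← hrestu 0, hslide 0, hy0]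
      linarith

end Summit.FinalStateConjecture.FinalStateConjecture.Theorems.SymplecticDualOfTheBomb

end
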